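import Summits.ResolutionOfSingularities.ResolutionOfSingularities.Theorems.FrobeniusLadderFInjectiveMacaulayficationQuarticTStep
import Summits.ResolutionOfSingularities.ResolutionOfSingularities.Theorems.FrobeniusLadderFInjectiveMacaulayficationQuarticVertexFull
import Summits.ResolutionOfSingularities.ResolutionOfSingularities.Theorems.FrobeniusLadderFInjectiveMacaulayficationX2CubicFormScope
import Summits.ResolutionOfSingularities.ResolutionOfSingularities.Theorems.FrobeniusLadderFInjectiveMacaulayficationX2CubicFormSmoothCert
import HarnessLib

/-!
# ★★★ T-INSTANCE #3 (habitat #3a): THE QUARTIC DOUBLE POINT `Y = {x² + y⁴ + u⁴ + t⁴ − s⁴ = 0} ⊂ 𝔸⁵_k` — `TStepInstanceAt p v 𝔪̃` for every field with `2 ≠ 0`, plus SCOPE and a FULL vertex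
# for every prime `p ≥ 5`: the point floor is NON-NORMAL (singular along the whole reduced exceptional divisor `E_red ≅ ℙ³`) and is regularised by ONE blowing up of `E_red` (codimension one)
# (crux `FInjectiveMacaulayfication` stmt-ResolutionOfSingularities-15315, chain w45a; application of ✓/⧗ `QuarticTStep.tStepInstanceAt_of_doublePoint_quarticCharts`; `Lines/T-I3-firststep.md`;
# seat res-L1-w45a-lead-1 g11)

[OURS · L1 W4.5a] Support file (`--supports stmt-ResolutionOfSingularities-15315 --as helper`); def-free; UNCONDITIONAL; no named fact; NOT a statement of any manuscript. An INSTANCE of the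
inner block of the T″ stub in a new habitat — evidence for nothing beyond itself; the legality-and-FULLness of the point floor as a T″ input (chartwise ✓p683974 `PinchFloorFull`) is
NOT assembled here; the T″ stub and the F-half stay OPEN; nothing of the crux is proved. AI-written (AI review is weaker than expert review).

* §1 the bed: `constantCoeff_f`, `f_not_mem_span_X`, `pderiv_f`, ★ `regular_off_vertex` (`2 ≠ 0`), `theta` (the five strict transforms, multiplicity 2: `G_a = X₄² + X_a²·w_a`, `G₄ = 1 + X₄²·F`).
* §2 `smooth_W`, `smooth_W'` — the chart quartics `1 + Z₀⁴ + Z₁⁴ − Z₂⁴`, `Z₀⁴ + Z₁⁴ + Z₂⁴ − 1` have smooth zero locus (Euler certificates with `¼`).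
* §3 ★★★ `tStepInstanceAt_quarticBed` (every field with `2 ≠ 0`, every `p`); ★★★ `tStep_scope_full_instance_quarticBed` (`p ≥ 5`: `v` closed ∧ singular ∧ `dim = 4` ∧ `FullCl p 𝒪_{Y,v}` ∧ instance).
[folklore; cite: Hartshorne1977, I Thm. 5.1; StacksProject, Tag 07PF; GortzWedhorn2020, Prop. 13.91 (2)]
-/

-- single-problem summit: the doubled namespace component is forced
set_option linter.dupNamespace false

noncomputable section

namespace Summit.ResolutionOfSingularities.ResolutionOfSingularities.Theorems.FInjectiveMacaulayfication.QuarticBed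

open MvPolynomial Literature.AlgebraicGeometry.Resolution AlgebraicGeometry CategoryTheory TopologicalSpace IsLocalRing
open Summit.ResolutionOfSingularities.ResolutionOfSingularities.Theorems.FInjectiveMacaulayfication
open SliceableCentre GermOfGlobalBlowup

variable (k : Type) [Field k]

/-! ## §1 The bed -/

/-- `f` has no constant term. [elementary] -/
theorem constantCoeff_f (f : MvPolynomial (Fin 5) k) (hf : f = X 4 ^ 2 + X 0 ^ 4 + X 1 ^ 4 + X 2 ^ 4 - X 3 ^ 4) : constantCoeff f = 0 := by
  rw [hf]; simp [constantCoeff_X]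

/-- `f ∉ (Xᵢ)`: evaluate at `e₄` (`i ≤ 3`) resp. `e₀` (`i = 4`). [elementary] -/
theorem f_not_mem_span_X (f : MvPolynomial (Fin 5) k) (hf : f = X 4 ^ 2 + X 0 ^ 4 + X 1 ^ 4 + X 2 ^ 4 - X 3 ^ 4) (i : Fin 5) :
    f ∉ Ideal.span {(X i : MvPolynomial (Fin 5) k)} := by
  intro h
  obtain ⟨c, hc⟩ := Ideal.mem_span_singleton.mp h
  by_cases hi : i = 4
  · subst hi
    have := congrArg (MvPolynomial.eval (Pi.single 0 1 : Fin 5 → k)) hc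
    rw [hf] at this
    simp at this
  · have := congrArg (MvPolynomial.eval (Pi.single 4 1 : Fin 5 → k)) hc
    rw [hf] at this
    simp [hi] at this

/-- The partials of `f`. [elementary] -/
theorem pderiv_f (f : MvPolynomial (Fin 5) k) (hf : f = X 4 ^ 2 + X 0 ^ 4 + X 1 ^ 4 + X 2 ^ 4 - X 3 ^ 4) :
    pderiv 4 f = 2 * X 4 ∧ pderiv 0 f = 4 * X 0 ^ 3 ∧ pderiv 1 f = 4 * X 1 ^ 3 ∧ pderiv 2 f = 4 * X 2 ^ 3 ∧ pderiv 3 f = -(4 * X 3 ^ 3) := by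
  subst hf
  refine ⟨?_, ?_, ?_, ?_, ?_⟩ <;>
  · simp only [map_add, map_sub, Derivation.leibniz_pow, pderiv_X_self, pderiv_X_of_ne (show (0 : Fin 5) ≠ 4 by decide), pderiv_X_of_ne (show (1 : Fin 5) ≠ 4 by decide),
      pderiv_X_of_ne (show (2 : Fin 5) ≠ 4 by decide), pderiv_X_of_ne (show (3 : Fin 5) ≠ 4 by decide), pderiv_X_of_ne (show (4 : Fin 5) ≠ 0 by decide),
      pderiv_X_of_ne (show (1 : Fin 5) ≠ 0 by decide), pderiv_X_of_ne (show (2 : Fin 5) ≠ 0 by decide), pderiv_X_of_ne (show (3 : Fin 5) ≠ 0 by decide),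
      pderiv_X_of_ne (show (4 : Fin 5) ≠ 1 by decide), pderiv_X_of_ne (show (0 : Fin 5) ≠ 1 by decide), pderiv_X_of_ne (show (2 : Fin 5) ≠ 1 by decide),
      pderiv_X_of_ne (show (3 : Fin 5) ≠ 1 by decide), pderiv_X_of_ne (show (4 : Fin 5) ≠ 2 by decide), pderiv_X_of_ne (show (0 : Fin 5) ≠ 2 by decide),
      pderiv_X_of_ne (show (1 : Fin 5) ≠ 2 by decide), pderiv_X_of_ne (show (3 : Fin 5) ≠ 2 by decide), pderiv_X_of_ne (show (4 : Fin 5) ≠ 3 by decide),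
      pderiv_X_of_ne (show (0 : Fin 5) ≠ 3 by decide), pderiv_X_of_ne (show (1 : Fin 5) ≠ 3 by decide), pderiv_X_of_ne (show (2 : Fin 5) ≠ 3 by decide),
      smul_eq_mul, mul_one, nsmul_eq_mul]
    push_cast; ring

/-- ★ **`Y` is regular off the vertex** (`2 ≠ 0`): some `X_j ∉ P′`, and then `∂_j f ∈ {2X₄, ±4X_j³}` misses `P′` (Jacobian criterion). [cite: Hartshorne1977, I Thm. 5.1] -/
theorem regular_off_vertex (h2 : (2 : k) ≠ 0) (f : MvPolynomial (Fin 5) k) (hf : f = X 4 ^ 2 + X 0 ^ 4 + X 1 ^ 4 + X 2 ^ 4 - X 3 ^ 4)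
    (P : Ideal (MvPolynomial (Fin 5) k ⧸ Ideal.span {f})) [P.IsPrime]
    (hP : ¬ Ideal.span (Set.range fun j : Fin 5 => Ideal.Quotient.mk (Ideal.span {f}) (X j)) ≤ P) :
    IsRegularLocalRing (Localization.AtPrime P) := by
  haveI hP' : (P.comap (Ideal.Quotient.mk (Ideal.span {f}))).IsPrime := Ideal.comap_isPrime _ _
  set P' := P.comap (Ideal.Quotient.mk (Ideal.span {f})) with hP'def
  have hex : ∃ j : Fin 5, (X j : MvPolynomial (Fin 5) k) ∉ P' := by
    by_contra hall
    push Not at hall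
    apply hP
    rw [Ideal.span_le]
    rintro _ ⟨j, rfl⟩
    exact hall j
  have h4 : (4 : k) ≠ 0 := by rw [show (4 : k) = 2 * 2 by norm_num]; exact mul_ne_zero h2 h2
  have hC2 := X2C31Specimen.C_not_mem k h2 P'
  have hC4 := X2C31Specimen.C_not_mem k h4 P'
  obtain ⟨d4, d0, d1, d2, d3⟩ := pderiv_f k f hf
  obtain ⟨j, hj⟩ := hex
  refine HypersurfaceRegular.stub_hypersurfaceRegularOfPderiv k 5 f j P ?_
  have key : ∀ (c : k) (hc : (C c : MvPolynomial (Fin 5) k) ∉ P') (n : ℕ), (C c : MvPolynomial (Fin 5) k) * X j ^ n ∉ P' := fun c hc n hm =>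
    (hP'.mem_or_mem hm).elim hc fun h' => hj (hP'.mem_of_pow_mem n h')
  have hj5 : j = 0 ∨ j = 1 ∨ j = 2 ∨ j = 3 ∨ j = 4 := by fin_cases j <;> simp
  rcases hj5 with rfl | rfl | rfl | rfl | rfl
  · rw [d0, show (4 : MvPolynomial (Fin 5) k) = C (4 : k) from (map_ofNat C 4).symm]; exact key 4 hC4 3
  · rw [d1, show (4 : MvPolynomial (Fin 5) k) = C (4 : k) from (map_ofNat C 4).symm]; exact key 4 hC4 3
  · rw [d2, show (4 : MvPolynomial (Fin 5) k) = C (4 : k) from (map_ofNat C 4).symm]; exact key 4 hC4 3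
  · rw [d3, neg_mem_iff, show (4 : MvPolynomial (Fin 5) k) = C (4 : k) from (map_ofNat C 4).symm]; exact key 4 hC4 3
  · rw [d4, show (2 : MvPolynomial (Fin 5) k) = C (2 : k) from (map_ofNat C 2).symm, ← pow_one (X 4 : MvPolynomial (Fin 5) k)]; exact key 2 hC2 1

/-- **The five strict transforms** (multiplicity `2`): `θ_a f = X_a²·(X₄² + X_a²·w_a)` (`a ≤ 3`, `w_a` the dehomogenised quartic, renamed into the chart variables) and
`θ₄ f = X₄²·(1 + X₄²·F)`. [folklore computation] -/
theorem theta (f : MvPolynomial (Fin 5) k) (hf : f = X 4 ^ 2 + X 0 ^ 4 + X 1 ^ 4 + X 2 ^ 4 - X 3 ^ 4) :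
    ∀ i : Fin 5, MvPolynomial.aeval (fun j : Fin 5 => if j = i then (X i : MvPolynomial (Fin 5) k) else X j * X i) f =
      X i ^ 2 * (![X 4 ^ 2 + X 0 ^ 2 * rename ((![![1, 2, 3], ![0, 2, 3], ![0, 1, 3], ![0, 1, 2]] : Fin 4 → Fin 3 → Fin 5) 0) ((![1 + X 0 ^ 4 + X 1 ^ 4 - X 2 ^ 4,
          1 + X 0 ^ 4 + X 1 ^ 4 - X 2 ^ 4, 1 + X 0 ^ 4 + X 1 ^ 4 - X 2 ^ 4, X 0 ^ 4 + X 1 ^ 4 + X 2 ^ 4 - 1] : Fin 4 → MvPolynomial (Fin 3) k) 0),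
        X 4 ^ 2 + X 1 ^ 2 * rename ((![![1, 2, 3], ![0, 2, 3], ![0, 1, 3], ![0, 1, 2]] : Fin 4 → Fin 3 → Fin 5) 1) ((![1 + X 0 ^ 4 + X 1 ^ 4 - X 2 ^ 4,
          1 + X 0 ^ 4 + X 1 ^ 4 - X 2 ^ 4, 1 + X 0 ^ 4 + X 1 ^ 4 - X 2 ^ 4, X 0 ^ 4 + X 1 ^ 4 + X 2 ^ 4 - 1] : Fin 4 → MvPolynomial (Fin 3) k) 1),
        X 4 ^ 2 + X 2 ^ 2 * rename ((![![1, 2, 3], ![0, 2, 3], ![0, 1, 3], ![0, 1, 2]] : Fin 4 → Fin 3 → Fin 5) 2) ((![1 + X 0 ^ 4 + X 1 ^ 4 - X 2 ^ 4,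
          1 + X 0 ^ 4 + X 1 ^ 4 - X 2 ^ 4, 1 + X 0 ^ 4 + X 1 ^ 4 - X 2 ^ 4, X 0 ^ 4 + X 1 ^ 4 + X 2 ^ 4 - 1] : Fin 4 → MvPolynomial (Fin 3) k) 2),
        X 4 ^ 2 + X 3 ^ 2 * rename ((![![1, 2, 3], ![0, 2, 3], ![0, 1, 3], ![0, 1, 2]] : Fin 4 → Fin 3 → Fin 5) 3) ((![1 + X 0 ^ 4 + X 1 ^ 4 - X 2 ^ 4,
          1 + X 0 ^ 4 + X 1 ^ 4 - X 2 ^ 4, 1 + X 0 ^ 4 + X 1 ^ 4 - X 2 ^ 4, X 0 ^ 4 + X 1 ^ 4 + X 2 ^ 4 - 1] : Fin 4 → MvPolynomial (Fin 3) k) 3),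
        1 + X 4 ^ 2 * (X 0 ^ 4 + X 1 ^ 4 + X 2 ^ 4 - X 3 ^ 4)] : Fin 5 → MvPolynomial (Fin 5) k) i := by
  intro i
  subst hf
  fin_cases i <;> simp <;> ring

/-! ## §2 The chart quartics have smooth zero locus -/

/-- **`V(1 + Z₀⁴ + Z₁⁴ − Z₂⁴)` is smooth** (`2 ≠ 0`; Euler: `W − Σ (Z_b/4)∂_bW = 1`). [elementary] -/
theorem smooth_W (h2 : (2 : k) ≠ 0) :
    ∀ 𝔮 : Ideal (MvPolynomial (Fin 3) k), 𝔮.IsPrime → (1 + X 0 ^ 4 + X 1 ^ 4 - X 2 ^ 4 : MvPolynomial (Fin 3) k) ∈ 𝔮 →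
      ∃ D : Derivation k (MvPolynomial (Fin 3) k) (MvPolynomial (Fin 3) k), D (1 + X 0 ^ 4 + X 1 ^ 4 - X 2 ^ 4 : MvPolynomial (Fin 3) k) ∉ 𝔮 := by
  have h4 : (4 : k) ≠ 0 := by rw [show (4 : k) = 2 * 2 by norm_num]; exact mul_ne_zero h2 h2
  have d0 : pderiv 0 (1 + X 0 ^ 4 + X 1 ^ 4 - X 2 ^ 4 : MvPolynomial (Fin 3) k) = 4 * X 0 ^ 3 := by
    simp only [map_add, map_sub, Derivation.map_one_eq_zero, Derivation.leibniz_pow, pderiv_X_self, pderiv_X_of_ne (show (1 : Fin 3) ≠ 0 by decide),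
      pderiv_X_of_ne (show (2 : Fin 3) ≠ 0 by decide), zero_add, smul_eq_mul, mul_one, nsmul_eq_mul]
    push_cast; ring
  have d1 : pderiv 1 (1 + X 0 ^ 4 + X 1 ^ 4 - X 2 ^ 4 : MvPolynomial (Fin 3) k) = 4 * X 1 ^ 3 := by
    simp only [map_add, map_sub, Derivation.map_one_eq_zero, Derivation.leibniz_pow, pderiv_X_self, pderiv_X_of_ne (show (0 : Fin 3) ≠ 1 by decide),
      pderiv_X_of_ne (show (2 : Fin 3) ≠ 1 by decide), zero_add, smul_eq_mul, mul_one, nsmul_eq_mul]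
    push_cast; ring
  have d2 : pderiv 2 (1 + X 0 ^ 4 + X 1 ^ 4 - X 2 ^ 4 : MvPolynomial (Fin 3) k) = -(4 * X 2 ^ 3) := by
    simp only [map_add, map_sub, Derivation.map_one_eq_zero, Derivation.leibniz_pow, pderiv_X_self, pderiv_X_of_ne (show (0 : Fin 3) ≠ 2 by decide),
      pderiv_X_of_ne (show (1 : Fin 3) ≠ 2 by decide), zero_add, smul_eq_mul, mul_one, nsmul_eq_mul]
    push_cast; ring
  refine X2CubicFormSmoothCert.smooth_of_jacobian_certificate k _ 1 (-(C (4 : k)⁻¹ * X 0)) (-(C (4 : k)⁻¹ * X 1)) (-(C (4 : k)⁻¹ * X 2)) ?_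
  rw [d0, d1, d2]
  have h4C : (C (4 : k)⁻¹ : MvPolynomial (Fin 3) k) * 4 = 1 := by rw [← map_ofNat C 4, ← map_mul, inv_mul_cancel₀ h4, map_one]
  linear_combination (-(X 0 ^ 4 + X 1 ^ 4 - X 2 ^ 4)) * h4C

/-- **`V(Z₀⁴ + Z₁⁴ + Z₂⁴ − 1)` is smooth** (`2 ≠ 0`; Euler: `Σ (Z_b/4)∂_bW′ − W′ = 1`). [elementary] -/
theorem smooth_W' (h2 : (2 : k) ≠ 0) :
    ∀ 𝔮 : Ideal (MvPolynomial (Fin 3) k), 𝔮.IsPrime → (X 0 ^ 4 + X 1 ^ 4 + X 2 ^ 4 - 1 : MvPolynomial (Fin 3) k) ∈ 𝔮 →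
      ∃ D : Derivation k (MvPolynomial (Fin 3) k) (MvPolynomial (Fin 3) k), D (X 0 ^ 4 + X 1 ^ 4 + X 2 ^ 4 - 1 : MvPolynomial (Fin 3) k) ∉ 𝔮 := by
  have h4 : (4 : k) ≠ 0 := by rw [show (4 : k) = 2 * 2 by norm_num]; exact mul_ne_zero h2 h2
  have d0 : pderiv 0 (X 0 ^ 4 + X 1 ^ 4 + X 2 ^ 4 - 1 : MvPolynomial (Fin 3) k) = 4 * X 0 ^ 3 := by
    simp only [map_add, map_sub, Derivation.map_one_eq_zero, Derivation.leibniz_pow, pderiv_X_self, pderiv_X_of_ne (show (1 : Fin 3) ≠ 0 by decide),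
      pderiv_X_of_ne (show (2 : Fin 3) ≠ 0 by decide), smul_eq_mul, mul_one, nsmul_eq_mul]
    push_cast; ring
  have d1 : pderiv 1 (X 0 ^ 4 + X 1 ^ 4 + X 2 ^ 4 - 1 : MvPolynomial (Fin 3) k) = 4 * X 1 ^ 3 := by
    simp only [map_add, map_sub, Derivation.map_one_eq_zero, Derivation.leibniz_pow, pderiv_X_self, pderiv_X_of_ne (show (0 : Fin 3) ≠ 1 by decide),
      pderiv_X_of_ne (show (2 : Fin 3) ≠ 1 by decide), smul_eq_mul, mul_one, nsmul_eq_mul]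
    push_cast; ring
  have d2 : pderiv 2 (X 0 ^ 4 + X 1 ^ 4 + X 2 ^ 4 - 1 : MvPolynomial (Fin 3) k) = 4 * X 2 ^ 3 := by
    simp only [map_add, map_sub, Derivation.map_one_eq_zero, Derivation.leibniz_pow, pderiv_X_self, pderiv_X_of_ne (show (0 : Fin 3) ≠ 2 by decide),
      pderiv_X_of_ne (show (1 : Fin 3) ≠ 2 by decide), smul_eq_mul, mul_one, nsmul_eq_mul]
    push_cast; ring
  refine X2CubicFormSmoothCert.smooth_of_jacobian_certificate k _ (-1) (C (4 : k)⁻¹ * X 0) (C (4 : k)⁻¹ * X 1) (C (4 : k)⁻¹ * X 2) ?_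
  rw [d0, d1, d2]
  have h4C : (C (4 : k)⁻¹ : MvPolynomial (Fin 3) k) * 4 = 1 := by rw [← map_ofNat C 4, ← map_mul, inv_mul_cancel₀ h4, map_one]
  linear_combination (X 0 ^ 4 + X 1 ^ 4 + X 2 ^ 4) * h4C

/-! ## §3 The instance -/

/-- ★★★ **T-INSTANCE #3: `TStepInstanceAt p v (𝔪̃·𝒪_{Y,v})` FOR THE QUARTIC DOUBLE POINT `x² + y⁴ + u⁴ + t⁴ − s⁴`**, every field with `2 ≠ 0`, every `p`: for every blowing up
`g : S′ → Spec 𝒪_{Y,v}` along `𝔪̃·𝒪_{Y,v}` there is a fibre-supported `𝓚 ≠ ⊥` (the reduced singular locus = the reduced exceptional divisor, codimension one in the NON-NORMAL floor)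
ALL of whose blowings up are REGULAR. [OURS · instance of `QuarticTStep.tStepInstanceAt_of_doublePoint_quarticCharts`; evidence for nothing beyond itself] -/
theorem tStepInstanceAt_quarticBed (h2 : (2 : k) ≠ 0) (p : ℕ) (f : MvPolynomial (Fin 5) k) (hf : f = X 4 ^ 2 + X 0 ^ 4 + X 1 ^ 4 + X 2 ^ 4 - X 3 ^ 4)
    (v : Spec (.of (MvPolynomial (Fin 5) k ⧸ Ideal.span {f})))
    (hv : v.asIdeal = Ideal.span (Set.range fun j : Fin 5 => Ideal.Quotient.mk (Ideal.span {f}) (X j))) :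
    TStepGerm.TStepInstanceAt p v ((affineBlowup.idealSheaf (Ideal.span (Set.range fun j : Fin 5 => Ideal.Quotient.mk (Ideal.span {f}) (X j)))).comap
      ((Spec (.of (MvPolynomial (Fin 5) k ⧸ Ideal.span {f}))).fromSpecStalk v)) := by
  have hq4 : pderiv 4 (X 0 ^ 4 + X 1 ^ 4 + X 2 ^ 4 - X 3 ^ 4 : MvPolynomial (Fin 5) k) = 0 := by
    simp only [map_add, map_sub, Derivation.leibniz_pow, pderiv_X_of_ne (show (0 : Fin 5) ≠ 4 by decide), pderiv_X_of_ne (show (1 : Fin 5) ≠ 4 by decide),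
      pderiv_X_of_ne (show (2 : Fin 5) ≠ 4 by decide), pderiv_X_of_ne (show (3 : Fin 5) ≠ 4 by decide), smul_zero, add_zero, sub_zero]
  refine QuarticTStep.tStepInstanceAt_of_doublePoint_quarticCharts k h2 p f (QuarticVertexFull.prime_f4 k h2 f hf) (constantCoeff_f k f hf) (f_not_mem_span_X k f hf)
    (fun P _ hP => regular_off_vertex k h2 f hf P hP) _ (theta k f hf)
    (![1 + X 0 ^ 4 + X 1 ^ 4 - X 2 ^ 4, 1 + X 0 ^ 4 + X 1 ^ 4 - X 2 ^ 4, 1 + X 0 ^ 4 + X 1 ^ 4 - X 2 ^ 4, X 0 ^ 4 + X 1 ^ 4 + X 2 ^ 4 - 1]) (fun a => ?_) (fun a => ?_)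
    (X 0 ^ 4 + X 1 ^ 4 + X 2 ^ 4 - X 3 ^ 4) rfl hq4 v hv
  · fin_cases a <;> rfl
  · fin_cases a
    · exact smooth_W k h2
    · exact smooth_W k h2
    · exact smooth_W k h2
    · exact smooth_W' k h2

/-- **`∇f(0) = 0`** for the quartic bed. [elementary] -/
theorem eval_zero_pderiv_f (f : MvPolynomial (Fin 5) k) (hf : f = X 4 ^ 2 + X 0 ^ 4 + X 1 ^ 4 + X 2 ^ 4 - X 3 ^ 4) (i : Fin 5) :
    MvPolynomial.eval (0 : Fin 5 → k) (pderiv i f) = 0 := by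
  obtain ⟨d4, d0, d1, d2, d3⟩ := pderiv_f k f hf
  have hi5 : i = 0 ∨ i = 1 ∨ i = 2 ∨ i = 3 ∨ i = 4 := by fin_cases i <;> simp
  rcases hi5 with rfl | rfl | rfl | rfl | rfl
  · rw [d0]; simp
  · rw [d1]; simp
  · rw [d2]; simp
  · rw [d3]; simp
  · rw [d4]; simp

/-- ★★★ **SCOPE ∧ FULL VERTEX ∧ INSTANCE for the quartic bed**, every prime `p ≥ 5`, every field of characteristic `p`: `v` is CLOSED, SINGULAR, `dim 𝒪_{Y,v} = 4`, `𝒪_{Y,v}` is FULL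
(✓p684332 `QuarticVertexFull`), and `TStepInstanceAt p v (𝔪̃·𝒪_{Y,v})` holds. (The legality-and-FULLness of the point floor as a T″ input — chartwise ✓p683974 — is not assembled here.)
[OURS · application] -/
theorem tStep_scope_full_instance_quarticBed (p : ℕ) [Fact p.Prime] [CharP k p] (hp2 : p ≠ 2) (hp3 : p ≠ 3) (f : MvPolynomial (Fin 5) k)
    (hf : f = X 4 ^ 2 + X 0 ^ 4 + X 1 ^ 4 + X 2 ^ 4 - X 3 ^ 4)
    (v : Spec (.of (MvPolynomial (Fin 5) k ⧸ Ideal.span {f})))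
    (hv : v.asIdeal = Ideal.span (Set.range fun j : Fin 5 => Ideal.Quotient.mk (Ideal.span {f}) (X j))) :
    (IsClosed ({v} : Set (Spec (.of (MvPolynomial (Fin 5) k ⧸ Ideal.span {f})))) ∧
      v ∉ Scheme.regularLocus (Spec (.of (MvPolynomial (Fin 5) k ⧸ Ideal.span {f}))) ∧
      ringKrullDim ((Spec (.of (MvPolynomial (Fin 5) k ⧸ Ideal.span {f}))).presheaf.stalk v) = (4 : ℕ)) ∧
    FullCl p ((Spec (.of (MvPolynomial (Fin 5) k ⧸ Ideal.span {f}))).presheaf.stalk v) ∧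
    TStepGerm.TStepInstanceAt p v ((affineBlowup.idealSheaf (Ideal.span (Set.range fun j : Fin 5 => Ideal.Quotient.mk (Ideal.span {f}) (X j)))).comap
      ((Spec (.of (MvPolynomial (Fin 5) k ⧸ Ideal.span {f}))).fromSpecStalk v)) := by
  classical
  have h2 : (2 : k) ≠ 0 := (X2Cubic4Specimen.two_three_ne_zero k p hp2 hp3).1
  have hprime := QuarticVertexFull.prime_f4 k h2 f hf
  have hf0 := constantCoeff_f k f hf
  haveI hmax : v.asIdeal.IsMaximal := by rw [hv]; exact DoublePointFermatCubicGerm.isMaximal_origin k f hf0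
  refine ⟨⟨DoublePointFermatCubicGerm.isClosed_origin k f hf0 v hv, ?_, ?_⟩, QuarticVertexFull.fullCl_stalk_quarticBed k p hp2 hp3 f hf v hmax,
    tStepInstanceAt_quarticBed k h2 p f hf v hv⟩
  · refine not_mem_regularLocus_Spec_of_not_isRegularLocalRing v ?_
    refine not_isRegularLocalRing_localization_of_pderiv_eval_eq_zero (0 : Fin 5 → k) hprime.ne_zero ?_ (eval_zero_pderiv_f k f hf) v.asIdeal ?_
    · rw [MvPolynomial.eval_zero]; exact hf0
    · rw [hv, DoublePointFermatCubicGerm.comap_origin k f hf0, MvPolynomial.eval_zero, Fedder.span_range_X_eq_ker]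
  · rw [ringKrullDim_stalk_Spec_eq]
    exact HypersurfaceLocalDim.stub_hypersurfaceLocalDim k 4 f hprime.ne_zero v.asIdeal

end Summit.ResolutionOfSingularities.ResolutionOfSingularities.Theorems.FInjectiveMacaulayfication.QuarticBed

end
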